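import Summits.AnomalousDissipation.AnomalousDissipation.Theorems.SolenoidalFractalHomogenisationLagrangianStepVmodCoarseDecay
import Literature.Analysis.FluidPDE.PassiveVectorTensorPropagatorUnique
import Literature.Analysis.FluidPDE.DivFreeProjectionFourier
import HarnessLib

/-!
# K1L_D (stmt-AnomalousDissipation-27980): (V_mod) flat stage — LOWER BOUNDS ON THE COARSE LOSSES for frequency-supported data
(helper; `--supports 27980 --as helper`; prover ad-sawtooth-k1loc-p1 g14; on top of `…VmodCoarseDecay` (modewise exponential decay).)

For the carrier-free constant-tensor propagator `U` (`𝔹 ∈ NearIso lo′ hi′`, `lo′ > 0`) and a datum `x ∈ V2` whose Fourier coefficients vanish below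
the frequency level `m` (`fc x k ≠ 0 ⇒ m ≤ |k|²`):
* `norm_sq_apply_le_exp_of_supp` — `‖U s t x‖² ≤ exp(−8π² lo′ m (t−s))·‖x‖²` (Parseval + modewise decay; general data through `P_σ`);
* `lossFwd_ge_of_supp` — `(1 − exp(−8π² lo′ m (t−s)))·‖x‖² ≤ lossFwd (U s t) x`;
* `lossAdj_ge_of_supp` — the same for `lossAdj` (the adjoint is the propagator of the reversed carrier-free problem with the transposed tensor,
  `IsPropagator.adjoint_eq`).
These are the denominators `√q_T`, `√q*_T` of the four blocks of `…VmodFlatBlocks` for slow (`m = |ℓ|²`) and fast (`m = (n/4)²`) data.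
Nothing about the blocks, the stub, K1L_D or AD is proved here (rung F-D1.A0).
-/

set_option linter.dupNamespace false

noncomputable section

namespace Summit.AnomalousDissipation.AnomalousDissipation.Theorems.SolenoidalFractalHomogenisation.LagrangianStep.VmodFlat

open Literature.Analysis Literature.Analysis.FluidPDE Literature.Analysis.FunctionSpaces
open MeasureTheory Set Filter UnitAddTorus
open scoped ENNReal NNReal InnerProductSpace
open Summit.AnomalousDissipation.AnomalousDissipation.Theorems.SolenoidalFractalHomogenisation.LagrangianStep.CellClauseMod

/-- **Energy decay for frequency-supported data** of a carrier-free propagator: if the Fourier coefficients of `x` vanish wherever `|k|² < m`, then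
`‖U s t x‖² ≤ exp(−8π² lo′ m (t−s))·‖x‖²` (`0 ≤ s ≤ t ≤ T₀`). [folklore] -/
theorem norm_sq_apply_le_exp_of_supp {T₀ : ℝ} {𝔹 : Torus.Visc4 (Fin 3)} {lo' hi' : ℝ} (h𝔹 : Torus.NearIso 𝔹 lo' hi') (hlo' : 0 < lo')
    {b : ℝ → VF} (hb : ∀ r y, b r y = 0) {U : ℝ → ℝ → (V2 →L[ℝ] V2)} (hU : Torus.IsPropagator T₀ b 𝔹 U)
    {s t : ℝ} (hs : 0 ≤ s) (hst : s ≤ t) (htT : t ≤ T₀) (x : V2) {m : ℝ} (hm0 : 0 ≤ m)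
    (hsupp : ∀ k, fc x k ≠ 0 → m ≤ Torus.freqNormSq k) :
    ‖U s t x‖ ^ 2 ≤ Real.exp (-(8 * Real.pi ^ 2 * lo' * m * (t - s))) * ‖x‖ ^ 2 := by
  obtain rfl : b = fun (_ : ℝ) (_ : UnitAddTorus (Fin 3)) => (0 : EuclideanSpace ℝ (Fin 3)) := funext fun r => funext fun y => hb r y
  set P := (Torus.divFreeL2 (Fin 3)).starProjection with hP
  set E : ℝ := Real.exp (-(8 * Real.pi ^ 2 * lo' * m * (t - s))) with hE
  have hE0 : 0 ≤ E := (Real.exp_pos _).le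
  have hE1 : E ≤ 1 := by
    rw [hE]; apply Real.exp_le_one_iff.2
    have : 0 ≤ 8 * Real.pi ^ 2 * lo' * m * (t - s) := by
      have := Real.pi_pos; have h2 : 0 ≤ t - s := by linarith
      positivity
    linarith
  have hPdiv : Torus.IsWeaklyDivFree (⇑(P x) : VF) := (Torus.mem_divFreeL2_iff _).1 ((Torus.divFreeL2 (Fin 3)).starProjection_apply_mem x)
  have hPn : ‖P x‖ ≤ ‖x‖ := (Torus.divFreeL2 (Fin 3)).norm_starProjection_apply_le x
  -- support of `P x` is inside that of `x`
  have hsuppP : ∀ k, fc (P x) k ≠ 0 → m ≤ Torus.freqNormSq k := by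
    intro k hk
    refine hsupp k fun h0 => hk ?_
    have h := Torus.norm_mFourierCoeff_starProjection_le x k
    have : ‖fc (P x) k‖ ≤ 0 := by calc ‖fc (P x) k‖ ≤ ‖fc x k‖ := h
                                      _ = 0 := by rw [h0, norm_zero]
    exact norm_le_zero_iff.1 this
  rw [hU.apply_eq_apply_starProjection s t x]
  rcases lt_or_eq_of_le (hst.trans htT) with hsT | hsT
  · -- modewise: `‖𝓕(U (P x))(k)‖² ≤ E·‖𝓕(P x)(k)‖²` (decay, and the rate only improves on the support)
    have hmode : ∀ k, ‖fc (U s t (P x)) k‖ ^ 2 ≤ E * ‖fc (P x) k‖ ^ 2 := by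
      intro k
      have hdec := norm_sq_fcoeff_carrierFree_decay h𝔹 hlo' hU hs hst htT hsT (P x) hPdiv k
      by_cases h0 : fc (P x) k = 0
      · have : ‖fc (U s t (P x)) k‖ ^ 2 ≤ 0 := by
          calc ‖fc (U s t (P x)) k‖ ^ 2 ≤ Real.exp (-(8 * Real.pi ^ 2 * lo' * Torus.freqNormSq k * (t - s))) * ‖fc (P x) k‖ ^ 2 := hdec
            _ = 0 := by rw [h0, norm_zero]; ring
        rw [h0, norm_zero]; simpa using this
      · have hmk := hsuppP k h0
        refine hdec.trans (mul_le_mul_of_nonneg_right ?_ (sq_nonneg _))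
        rw [hE]; apply Real.exp_le_exp.2
        have h2 : 0 ≤ t - s := by linarith
        have : 8 * Real.pi ^ 2 * lo' * m * (t - s) ≤ 8 * Real.pi ^ 2 * lo' * Torus.freqNormSq k * (t - s) := by
          have := Real.pi_pos
          apply mul_le_mul_of_nonneg_right _ h2
          exact mul_le_mul_of_nonneg_left hmk (by positivity)
        linarith
    -- Parseval on both sides
    have h1 := hasSum_norm_sq_fcoeff (U s t (P x))
    have h2 := (hasSum_norm_sq_fcoeff (P x)).mul_left E
    have hle : ‖U s t (P x)‖ ^ 2 ≤ E * ‖P x‖ ^ 2 := hasSum_le (fun k => hmode k) h1 h2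
    calc ‖U s t (P x)‖ ^ 2 ≤ E * ‖P x‖ ^ 2 := hle
      _ ≤ E * ‖x‖ ^ 2 := mul_le_mul_of_nonneg_left (pow_le_pow_left₀ (norm_nonneg _) hPn 2) hE0
  · -- `s = T₀ = t`
    have hts : t = s := le_antisymm (hsT ▸ htT) hst
    have hE' : E = 1 := by rw [hE, hts, sub_self, mul_zero, neg_zero, Real.exp_zero]
    rw [hts, hU.self_of_divFree s hs (le_of_eq hsT) (P x) hPdiv, hE', one_mul]
    exact pow_le_pow_left₀ (norm_nonneg _) hPn 2

/-- **Forward coarse loss of frequency-supported data**: `(1 − exp(−8π² lo′ m (t−s)))·‖x‖² ≤ lossFwd (U s t) x`. [folklore] -/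
theorem lossFwd_ge_of_supp {T₀ : ℝ} {𝔹 : Torus.Visc4 (Fin 3)} {lo' hi' : ℝ} (h𝔹 : Torus.NearIso 𝔹 lo' hi') (hlo' : 0 < lo')
    {b : ℝ → VF} (hb : ∀ r y, b r y = 0) {U : ℝ → ℝ → (V2 →L[ℝ] V2)} (hU : Torus.IsPropagator T₀ b 𝔹 U)
    {s t : ℝ} (hs : 0 ≤ s) (hst : s ≤ t) (htT : t ≤ T₀) (x : V2) {m : ℝ} (hm0 : 0 ≤ m)
    (hsupp : ∀ k, fc x k ≠ 0 → m ≤ Torus.freqNormSq k) :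
    (1 - Real.exp (-(8 * Real.pi ^ 2 * lo' * m * (t - s)))) * ‖x‖ ^ 2 ≤ lossFwd (U s t) x := by
  unfold lossFwd
  have h := norm_sq_apply_le_exp_of_supp h𝔹 hlo' hb hU hs hst htT x hm0 hsupp
  linarith

/-- **Adjoint coarse loss of frequency-supported data**: `(1 − exp(−8π² lo′ m (t−s)))·‖ζ‖² ≤ lossAdj (U s t) ζ` (the adjoint of a carrier-free
window map is the carrier-free propagator of the transposed tensor, same ellipticity window). [folklore] -/
theorem lossAdj_ge_of_supp {T₀ : ℝ} {𝔹 : Torus.Visc4 (Fin 3)} {lo' hi' : ℝ} (h𝔹 : Torus.NearIso 𝔹 lo' hi') (hlo' : 0 < lo')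
    {U : ℝ → ℝ → (V2 →L[ℝ] V2)}
    (hU : Torus.IsPropagator T₀ (fun (_ : ℝ) (_ : UnitAddTorus (Fin 3)) => (0 : EuclideanSpace ℝ (Fin 3))) 𝔹 U)
    {s t : ℝ} (hs : 0 ≤ s) (hst : s ≤ t) (htT : t ≤ T₀) (ζ : V2) {m : ℝ} (hm0 : 0 ≤ m)
    (hsupp : ∀ k, fc ζ k ≠ 0 → m ≤ Torus.freqNormSq k) :
    (1 - Real.exp (-(8 * Real.pi ^ 2 * lo' * m * (t - s)))) * ‖ζ‖ ^ 2 ≤ lossAdj (U s t) ζ := by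
  unfold lossAdj
  rcases hst.eq_or_lt with hEq | hLt
  · subst hEq
    have h0 : Real.exp (-(8 * Real.pi ^ 2 * lo' * m * (s - s))) = 1 := by rw [sub_self, mul_zero, neg_zero, Real.exp_zero]
    rw [h0, sub_self, zero_mul]
    have := LossCurrency.lossAdj_nonneg (hU.norm_le s s) ζ
    exact this
  · have hb : MemLp (Torus.stLift (fun (_ : ℝ) (_ : UnitAddTorus (Fin 3)) => (0 : EuclideanSpace ℝ (Fin 3)))) ∞
        (volume.restrict (Ioo 0 T₀ ×ˢ (univ : Set (EuclideanSpace ℝ (Fin 3))))) := memLp_top_const 0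
    have hbdiv : ∀ᵐ τ ∂(volume.restrict (Ioo (0:ℝ) T₀)),
        Torus.IsWeaklyDivFree ((fun (_ : ℝ) (_ : UnitAddTorus (Fin 3)) => (0 : EuclideanSpace ℝ (Fin 3))) τ) :=
      ae_of_all _ fun τ θ hθ => by simp
    rw [hU.adjoint_eq h𝔹 hlo' hb hbdiv hs hLt htT]
    have h𝔹' := (Torus.nearIso_majorTranspose_iff 𝔹 lo' hi').2 h𝔹
    have hV := Torus.isPropagator_propagator h𝔹' hlo'
      (Torus.memLp_top_stLift_reversed_window hb hs htT) (Torus.ae_isWeaklyDivFree_reversed_window hbdiv hs htT)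
    have h := norm_sq_apply_le_exp_of_supp h𝔹' hlo' (fun r y => by simp) hV le_rfl (by linarith) le_rfl ζ hm0 hsupp
    rw [sub_zero] at h
    linarith

end Summit.AnomalousDissipation.AnomalousDissipation.Theorems.SolenoidalFractalHomogenisation.LagrangianStep.VmodFlat

end
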